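import Summits.RiemannHypothesis.RiemannHypothesis.Theorems.LiAsymptoticDefs
import HarnessLib

/-!
# RiemannHypothesis / LiAsymptotic — crux K2 `LiSmoothMainTerm`, stub K2c part 1: the LOWER CUT (RH-FREE)

RH-FREE [rh-li-prover].  Route `Theses/LiAsymptotic.lean` (rung L-P(P1⁺) «Li asymptotic law, quadratic range»,
cell `pub/rh-li`, theory memo `theory/TARGETS.md` §11.2 STEP 6 (6d)), item `LiSmoothMainTerm`
(stmt-RiemannHypothesis-19162), first half of the registered birth stub `stub_cuts` (K2c): the oscillatory part of the
lower cut of the model integral,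

  `|∫_0^a cos(n/t) log(t/2π) dt| ≤ log 2π + 1 + (2a² log(a/2π) + 70)/n`   (`n ≥ 1`, `a ≥ 2π`),

so `≤ log n − log 2π + 1.7` at `a = √n`.  Proof: on `(0, 1]` the integrand is bounded by `log 2π − log t`, whose integral
is `log 2π + 1`; on `[1, a]` integrate by parts against `d sin(n/t) = −(n/t²) cos(n/t) dt` with `u = t² log(t/2π)`,
`u' = t(2 log(t/2π) + 1)`: boundary terms `a² log(a/2π)` and `log 2π ≤ 2`, and `∫_1^a |u'| ≤ 60 + (a² log(a/2π) + 8)`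
(`|u'| ≤ 20` on `[1, 4]`, `u' ≥ 0` on `[4, a]` since `log(π/2) ≤ ½`).  Also here: interval-integrability of
`log(t/2π)`, `cos(n/t) log(t/2π)` and `(1 − cos(n/t)) log(t/2π)` down to `t = 0`, and `∫_0^a log(t/2π) = a log(a/2π) − a`.
Elementary real analysis; nothing here bears on the truth of RH.
-/

noncomputable section

-- D-0017: `Summit.<S>.<S>.…` is the designed namespace of a single-problem summit.
set_option linter.dupNamespace false

open MeasureTheory intervalIntegral Set
open scoped Real Interval

namespace Summit.RiemannHypothesis.RiemannHypothesis.Theorems.LiTheory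

namespace SmoothCuts

/-! ### The weight `ℓ(t) = log(t/2π)` -/

/-- `log 2π ∈ [1.6931, 2]`. -/
theorem log_two_pi_mem : (1.6931 : ℝ) ≤ Real.log (2 * π) ∧ Real.log (2 * π) ≤ 2 := by
  have h2 := Real.log_two_gt_d9
  have he := Real.exp_one_lt_d9
  have he' := Real.exp_one_gt_d9
  have hπ3 := Real.pi_gt_d2
  have hπ4 := Real.pi_lt_d2
  constructor
  · have hπ : 1 ≤ Real.log π := by
      rw [Real.le_log_iff_exp_le Real.pi_pos]; linarith
    rw [Real.log_mul (by norm_num) Real.pi_pos.ne']; linarith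
  · rw [Real.log_le_iff_le_exp (by positivity)]
    have h4 : Real.exp 2 = Real.exp 1 * Real.exp 1 := by rw [← Real.exp_add]; norm_num
    rw [h4]; nlinarith

/-- `ℓ(t) = log t − log 2π` for `t ≠ 0`. -/
theorem ell_eq {t : ℝ} (ht : t ≠ 0) : Real.log (t / (2 * π)) = Real.log t - Real.log (2 * π) :=
  Real.log_div ht (by positivity)

/-- `ℓ'(t) = 1/t`. -/
theorem hasDerivAt_ell {t : ℝ} (ht : t ≠ 0) : HasDerivAt (fun y : ℝ ↦ Real.log (y / (2 * π))) t⁻¹ t := by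
  have h2π : (2 : ℝ) * π ≠ 0 := by positivity
  have hne : t / (2 * π) ≠ 0 := div_ne_zero ht h2π
  have h := (Real.hasDerivAt_log hne).comp t ((hasDerivAt_id t).div_const (2 * π))
  have h' : HasDerivAt (fun y : ℝ ↦ Real.log (y / (2 * π))) ((t / (2 * π))⁻¹ * (1 / (2 * π))) t := h
  refine h'.congr_deriv ?_
  rw [inv_div, div_mul_div_comm, mul_one, mul_comm t, ← div_div, div_self h2π, one_div]

/-- `ℓ` is interval-integrable on `[0, b]` (as `log` is). -/
theorem intervalIntegrable_ell (b : ℝ) (hb : 0 ≤ b) :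
    IntervalIntegrable (fun t : ℝ ↦ Real.log (t / (2 * π))) volume 0 b := by
  have h : IntervalIntegrable (fun t : ℝ ↦ Real.log t - Real.log (2 * π)) volume 0 b :=
    intervalIntegral.intervalIntegrable_log'.sub intervalIntegrable_const
  refine h.congr ?_
  rw [uIoc_of_le hb]
  intro t ht
  exact (ell_eq ht.1.ne').symm

/-- `∫_0^a ℓ = a log(a/2π) − a` (`a > 0`). -/
theorem integral_ell {a : ℝ} (ha : 0 < a) :
    ∫ t in (0 : ℝ)..a, Real.log (t / (2 * π)) = a * Real.log (a / (2 * π)) - a := by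
  have hcongr : ∫ t in (0 : ℝ)..a, Real.log (t / (2 * π)) = ∫ t in (0 : ℝ)..a, (Real.log t - Real.log (2 * π)) := by
    refine intervalIntegral.integral_congr_ae ?_
    rw [uIoc_of_le ha.le]
    exact Filter.Eventually.of_forall fun t ht ↦ ell_eq ht.1.ne'
  rw [hcongr, intervalIntegral.integral_sub intervalIntegral.intervalIntegrable_log' intervalIntegrable_const,
    integral_log, intervalIntegral.integral_const, ell_eq ha.ne']
  simp
  ring

/-- A continuous-on-`(0, b]` function dominated by a multiple of `|ℓ|` is interval-integrable on `[0, b]`. -/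
theorem intervalIntegrable_of_le_ell {f : ℝ → ℝ} {b K : ℝ} (hb : 0 ≤ b)
    (hf : ContinuousOn f (Ioc 0 b)) (hle : ∀ t ∈ Ioc 0 b, |f t| ≤ K * |Real.log (t / (2 * π))|) :
    IntervalIntegrable f volume 0 b := by
  refine IntervalIntegrable.mono_fun' (((intervalIntegrable_ell b hb).norm).const_mul K) ?_ ?_
  · rw [uIoc_of_le hb]; exact hf.aestronglyMeasurable measurableSet_Ioc
  · rw [uIoc_of_le hb]
    filter_upwards [ae_restrict_mem measurableSet_Ioc] with t ht
    simpa [Real.norm_eq_abs] using hle t ht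

/-- `cos(n/t) ℓ(t)` is interval-integrable on `[0, b]`. -/
theorem intervalIntegrable_cos_mul_ell (n : ℕ) {b : ℝ} (hb : 0 ≤ b) :
    IntervalIntegrable (fun t : ℝ ↦ Real.cos (n / t) * Real.log (t / (2 * π))) volume 0 b := by
  refine intervalIntegrable_of_le_ell (K := 1) hb ?_ fun t ht ↦ ?_
  · refine continuousOn_of_forall_continuousAt fun t ht ↦ ?_
    have h1 : t ≠ 0 := ht.1.ne'
    have h2 : t / (2 * π) ≠ 0 := by have := ht.1; positivity
    fun_prop (disch := assumption)
  · rw [abs_mul, one_mul]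
    exact mul_le_of_le_one_left (abs_nonneg _) (Real.abs_cos_le_one _)

/-- `(1 − cos(n/t)) ℓ(t)` is interval-integrable on `[0, b]`. -/
theorem intervalIntegrable_G (n : ℕ) {b : ℝ} (hb : 0 ≤ b) :
    IntervalIntegrable (fun t : ℝ ↦ (1 - Real.cos (n / t)) * Real.log (t / (2 * π))) volume 0 b := by
  refine intervalIntegrable_of_le_ell (K := 2) hb ?_ fun t ht ↦ ?_
  · refine continuousOn_of_forall_continuousAt fun t ht ↦ ?_
    have h1 : t ≠ 0 := ht.1.ne'
    have h2 : t / (2 * π) ≠ 0 := by have := ht.1; positivity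
    fun_prop (disch := assumption)
  · rw [abs_mul]
    refine mul_le_mul_of_nonneg_right ?_ (abs_nonneg _)
    have := Real.cos_le_one (n / t); have := Real.neg_one_le_cos (n / t)
    rw [abs_le]; constructor <;> linarith

/-! ### The piece `(0, 1]` -/

/-- `|∫_0^1 cos(n/t) ℓ(t) dt| ≤ log 2π + 1`. -/
theorem abs_integral_low0 (n : ℕ) :
    |∫ t in (0 : ℝ)..1, Real.cos (n / t) * Real.log (t / (2 * π))| ≤ Real.log (2 * π) + 1 := by
  obtain ⟨hℓ0, -⟩ := log_two_pi_mem
  have hle : ∀ᵐ t ∂volume, t ∈ Ioc (0 : ℝ) 1 →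
      ‖Real.cos (n / t) * Real.log (t / (2 * π))‖ ≤ Real.log (2 * π) - Real.log t :=
    Filter.Eventually.of_forall fun t ht ↦ by
      rw [Real.norm_eq_abs, abs_mul, ell_eq ht.1.ne']
      have hlt : Real.log t ≤ 0 := Real.log_nonpos ht.1.le ht.2
      have h1 : |Real.log t - Real.log (2 * π)| = Real.log (2 * π) - Real.log t := by
        rw [abs_of_nonpos (by linarith)]; ring
      rw [h1]
      exact mul_le_of_le_one_left (by linarith) (Real.abs_cos_le_one _)
  have hint : IntervalIntegrable (fun t : ℝ ↦ Real.log (2 * π) - Real.log t) volume 0 1 :=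
    intervalIntegrable_const.sub intervalIntegral.intervalIntegrable_log'
  have h := intervalIntegral.norm_integral_le_of_norm_le zero_le_one hle hint
  rw [intervalIntegral.integral_sub intervalIntegrable_const intervalIntegral.intervalIntegrable_log',
    intervalIntegral.integral_const, integral_log, Real.norm_eq_abs] at h
  simpa using h

/-! ### The piece `[1, a]`: integration by parts -/

/-- `log(π/2) ≤ ½` (`(π/2)² < e`). -/
theorem log_pi_div_two_le : Real.log (π / 2) ≤ 1 / 2 := by
  rw [Real.log_le_iff_le_exp (by positivity)]
  have h1 : (π / 2) ^ 2 < Real.exp (1 / 2) ^ 2 := by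
    rw [← Real.exp_nat_mul]; norm_num
    have := Real.exp_one_gt_d9; have := Real.pi_lt_d2; have := Real.pi_pos; nlinarith
  exact (pow_lt_pow_iff_left₀ (by positivity) (Real.exp_pos _).le two_ne_zero).1 h1 |>.le

/-- By parts on `[1, a]` (`n ≥ 1`, `a ≥ 2π`): `|∫_1^a cos(n/t) ℓ(t) dt| ≤ (2a² ℓ(a) + 70)/n`. -/
theorem abs_integral_low1 {n : ℕ} (hn : 1 ≤ n) {a : ℝ} (ha : 2 * π ≤ a) :
    |∫ t in (1 : ℝ)..a, Real.cos (n / t) * Real.log (t / (2 * π))| ≤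
      (2 * (a ^ 2 * Real.log (a / (2 * π))) + 70) / n := by
  obtain ⟨hℓlo, hℓhi⟩ := log_two_pi_mem
  have hπ3 := Real.pi_gt_three
  have ha4 : 4 ≤ a := by linarith
  have ha1 : (1 : ℝ) ≤ a := by linarith
  have hn0 : (0 : ℝ) < n := by exact_mod_cast hn
  -- `u = t² ℓ(t)`, `v = sin(n/t)`
  set u : ℝ → ℝ := fun t ↦ t ^ 2 * Real.log (t / (2 * π)) with hu
  set u' : ℝ → ℝ := fun t ↦ t * (2 * Real.log (t / (2 * π)) + 1) with hu'
  set v : ℝ → ℝ := fun t ↦ Real.sin (n / t) with hv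
  set v' : ℝ → ℝ := fun t ↦ Real.cos (n / t) * (n * -(t ^ 2)⁻¹) with hv'
  have hdu : ∀ t : ℝ, t ≠ 0 → HasDerivAt u (u' t) t := by
    intro t ht
    have h := (hasDerivAt_pow 2 t).mul (hasDerivAt_ell ht)
    refine h.congr_deriv ?_
    simp only [hu', Nat.cast_ofNat]
    field_simp
    ring
  have hdv : ∀ t : ℝ, t ≠ 0 → HasDerivAt v (v' t) t := by
    intro t ht
    have h1 : HasDerivAt (fun y : ℝ ↦ (n : ℝ) / y) (n * -(t ^ 2)⁻¹) t := by
      simpa [div_eq_mul_inv] using (hasDerivAt_inv ht).const_mul (n : ℝ)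
    exact h1.sin
  -- by parts on `[x, y] ⊂ (0, ∞)`
  have hparts : ∀ x y : ℝ, 0 < x → x ≤ y →
      ∫ t in x..y, Real.cos (n / t) * Real.log (t / (2 * π)) =
        -(1 / n) * (u y * v y - u x * v x - ∫ t in x..y, u' t * v t) := by
    intro x y hx hxy
    have hne : ∀ t ∈ uIcc x y, t ≠ 0 := fun t ht ↦ by
      rw [uIcc_of_le hxy] at ht; linarith [ht.1]
    have hcu' : ContinuousOn u' (uIcc x y) := by
      refine continuousOn_of_forall_continuousAt fun t ht ↦ ?_
      have h1 := hne t ht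
      have h2 : t / (2 * π) ≠ 0 := by
        rw [uIcc_of_le hxy] at ht; have := ht.1; positivity
      simp only [hu']
      fun_prop (disch := assumption)
    have hcv' : ContinuousOn v' (uIcc x y) := by
      refine continuousOn_of_forall_continuousAt fun t ht ↦ ?_
      have h1 := hne t ht
      have h3 : t ^ 2 ≠ 0 := pow_ne_zero 2 h1
      simp only [hv']
      fun_prop (disch := assumption)
    have hip := intervalIntegral.integral_mul_deriv_eq_deriv_mul (fun t ht ↦ hdu t (hne t ht))
      (fun t ht ↦ hdv t (hne t ht)) hcu'.intervalIntegrable hcv'.intervalIntegrable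
    have hcongr : ∫ t in x..y, Real.cos (n / t) * Real.log (t / (2 * π)) = ∫ t in x..y, -(1 / n) * (u t * v' t) := by
      refine intervalIntegral.integral_congr fun t ht ↦ ?_
      have h1 := hne t ht
      have h2 : (t ^ 2)⁻¹ * t ^ 2 = 1 := inv_mul_cancel₀ (pow_ne_zero 2 h1)
      have h3 : (1 : ℝ) / n * n = 1 := by rw [one_div, inv_mul_cancel₀ hn0.ne']
      simp only [hu, hv']
      calc Real.cos (n / t) * Real.log (t / (2 * π))
          = Real.cos (n / t) * Real.log (t / (2 * π)) * ((1 : ℝ) / n * n) * ((t ^ 2)⁻¹ * t ^ 2) := by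
            rw [h2, h3]; ring
        _ = -(1 / n) * (t ^ 2 * Real.log (t / (2 * π)) * (Real.cos (n / t) * (n * -(t ^ 2)⁻¹))) := by ring
    rw [hcongr, intervalIntegral.integral_const_mul, hip]
  -- values and bounds
  have hℓa : 0 ≤ Real.log (a / (2 * π)) := Real.log_nonneg (by rw [le_div_iff₀ (by positivity)]; linarith)
  have hℓ4 : -(1 / 2 : ℝ) ≤ Real.log (4 / (2 * π)) := by
    have hmul : Real.log (4 / (2 * π)) + Real.log (π / 2) = 0 := by
      rw [← Real.log_mul (by positivity) (by positivity)]
      have e : (4 : ℝ) / (2 * π) * (π / 2) = 1 := by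
        rw [div_mul_div_comm, div_eq_one_iff_eq (by positivity)]; ring
      rw [e, Real.log_one]
    linarith [log_pi_div_two_le]
  have hℓmono : ∀ s t : ℝ, 0 < s → s ≤ t → Real.log (s / (2 * π)) ≤ Real.log (t / (2 * π)) := fun s t hs hst ↦
    Real.log_le_log (by positivity) (by gcongr)
  have hua : u a = a ^ 2 * Real.log (a / (2 * π)) := rfl
  have hu1 : |u 1| ≤ 2 := by
    simp only [hu, one_pow, one_mul, ell_eq one_ne_zero, Real.log_one, zero_sub, abs_neg]
    rw [abs_of_nonneg (by linarith)]; exact hℓhi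
  have hu4 : -8 ≤ u 4 := by simp only [hu]; nlinarith
  have hvb : ∀ t, |v t| ≤ 1 := fun t ↦ Real.abs_sin_le_one _
  -- `∫_1^4 |u' v| ≤ 60`
  have hI14 : |∫ t in (1 : ℝ)..4, u' t * v t| ≤ 60 := by
    have hpt : ∀ t ∈ Ι (1 : ℝ) 4, ‖u' t * v t‖ ≤ 20 := by
      intro t ht
      rw [uIoc_of_le (by norm_num)] at ht
      rw [Real.norm_eq_abs, abs_mul]
      have ht0 : 0 < t := by linarith [ht.1]
      have hℓt : |Real.log (t / (2 * π))| ≤ 2 := by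
        have hlo : Real.log (1 / (2 * π)) ≤ Real.log (t / (2 * π)) := hℓmono 1 t one_pos ht.1.le
        have hhi : Real.log (t / (2 * π)) ≤ Real.log (4 / (2 * π)) := hℓmono t 4 ht0 ht.2
        have h4' : Real.log (4 / (2 * π)) ≤ 0 := Real.log_nonpos (by positivity) (by
          rw [div_le_one (by positivity)]; linarith)
        rw [ell_eq one_ne_zero, Real.log_one, zero_sub] at hlo
        rw [abs_le]; constructor <;> linarith
      have hu't : |u' t| ≤ 20 := by
        simp only [hu', abs_mul, abs_of_pos ht0]
        have : |2 * Real.log (t / (2 * π)) + 1| ≤ 5 := by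
          have := abs_le.1 hℓt; rw [abs_le]; constructor <;> linarith
        nlinarith [abs_nonneg (2 * Real.log (t / (2 * π)) + 1), ht.2]
      calc |u' t| * |v t| ≤ 20 * 1 := mul_le_mul hu't (hvb t) (abs_nonneg _) (by norm_num)
        _ = 20 := by norm_num
    have h := intervalIntegral.norm_integral_le_of_norm_le_const hpt
    rw [Real.norm_eq_abs] at h
    refine h.trans ?_; norm_num
  -- `∫_4^a |u' v| ≤ u a − u 4`
  have hI4a : |∫ t in (4 : ℝ)..a, u' t * v t| ≤ u a - u 4 := by
    have hle : ∀ᵐ t ∂volume, t ∈ Ioc (4 : ℝ) a → ‖u' t * v t‖ ≤ u' t :=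
      Filter.Eventually.of_forall fun t ht ↦ by
        have ht0 : 0 < t := by linarith [ht.1]
        have hpos : 0 ≤ 2 * Real.log (t / (2 * π)) + 1 := by
          linarith [hℓmono 4 t (by norm_num) ht.1.le]
        have hu'0 : 0 ≤ u' t := by simp only [hu']; exact mul_nonneg ht0.le hpos
        rw [Real.norm_eq_abs, abs_mul, abs_of_nonneg hu'0]
        exact mul_le_of_le_one_right hu'0 (hvb t)
    have hcu' : ContinuousOn u' (uIcc 4 a) := by
      refine continuousOn_of_forall_continuousAt fun t ht ↦ ?_
      rw [uIcc_of_le ha4] at ht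
      have h1 : t ≠ 0 := by linarith [ht.1]
      have h2 : t / (2 * π) ≠ 0 := by have := ht.1; positivity
      simp only [hu']
      fun_prop (disch := assumption)
    have h := intervalIntegral.norm_integral_le_of_norm_le ha4 hle hcu'.intervalIntegrable
    rw [intervalIntegral.integral_eq_sub_of_hasDerivAt (fun t ht ↦ hdu t (by
      rw [uIcc_of_le ha4] at ht; linarith [ht.1])) hcu'.intervalIntegrable, Real.norm_eq_abs] at h
    exact h
  -- assemble
  have hsplit : ∫ t in (1 : ℝ)..a, u' t * v t = (∫ t in (1 : ℝ)..4, u' t * v t) + ∫ t in (4 : ℝ)..a, u' t * v t := by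
    have hc : ∀ x y : ℝ, 0 < x → x ≤ y → IntervalIntegrable (fun t ↦ u' t * v t) volume x y := by
      intro x y hx hxy
      refine ContinuousOn.intervalIntegrable (continuousOn_of_forall_continuousAt fun t ht ↦ ?_)
      rw [uIcc_of_le hxy] at ht
      have h1 : t ≠ 0 := by linarith [ht.1]
      have h2 : t / (2 * π) ≠ 0 := by have := ht.1; positivity
      simp only [hu', hv]
      fun_prop (disch := assumption)
    exact (intervalIntegral.integral_add_adjacent_intervals (hc 1 4 one_pos (by norm_num)) (hc 4 a (by norm_num) ha4)).symm
  rw [hparts 1 a one_pos ha1, abs_mul, abs_neg, abs_of_pos (by positivity : (0 : ℝ) < 1 / n), hsplit,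
    show (2 * (a ^ 2 * Real.log (a / (2 * π))) + 70) / (n : ℝ) =
      1 / n * (2 * (a ^ 2 * Real.log (a / (2 * π))) + 70) by ring]
  refine mul_le_mul_of_nonneg_left ?_ (by positivity)
  have hva := hvb a; have hv1 := hvb 1
  have e1 : |u a * v a| ≤ a ^ 2 * Real.log (a / (2 * π)) := by
    rw [abs_mul, hua, abs_of_nonneg (by positivity)]
    exact mul_le_of_le_one_right (by positivity) hva
  have e2 : |u 1 * v 1| ≤ 2 := by
    rw [abs_mul]; exact (mul_le_mul hu1 hv1 (abs_nonneg _) (by norm_num)).trans (by norm_num)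
  have e3 := abs_add_le (∫ t in (1 : ℝ)..4, u' t * v t) (∫ t in (4 : ℝ)..a, u' t * v t)
  have htri : ∀ x y z : ℝ, |x - y - z| ≤ |x| + |y| + |z| := fun x y z ↦ by
    calc |x - y - z| ≤ |x - y| + |z| := abs_sub _ _
      _ ≤ |x| + |y| + |z| := by linarith [abs_sub x y]
  refine (htri _ _ _).trans ?_
  rw [hua] at hI4a
  linarith

/-- **The lower cut** (`n ≥ 1`, `a ≥ 2π`): `|∫_0^a cos(n/t) log(t/2π) dt| ≤ log 2π + 1 + (2a² log(a/2π) + 70)/n`. -/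
theorem abs_integral_low {n : ℕ} (hn : 1 ≤ n) {a : ℝ} (ha : 2 * π ≤ a) :
    |∫ t in (0 : ℝ)..a, Real.cos (n / t) * Real.log (t / (2 * π))| ≤
      Real.log (2 * π) + 1 + (2 * (a ^ 2 * Real.log (a / (2 * π))) + 70) / n := by
  have ha1 : (1 : ℝ) ≤ a := by linarith [Real.pi_gt_three]
  have i1 := intervalIntegrable_cos_mul_ell n (b := a) (by linarith)
  have i0 := intervalIntegrable_cos_mul_ell n (b := 1) zero_le_one
  have i1' : IntervalIntegrable (fun t : ℝ ↦ Real.cos (n / t) * Real.log (t / (2 * π))) volume 1 a :=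
    (i0.symm.trans i1)
  rw [← intervalIntegral.integral_add_adjacent_intervals i0 i1']
  exact (abs_add_le _ _).trans (add_le_add (abs_integral_low0 n) (abs_integral_low1 hn ha))

end SmoothCuts

end Summit.RiemannHypothesis.RiemannHypothesis.Theorems.LiTheory

end
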